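import Summits.Ventures.HodgeRepro2.T7SupportBergmanOneVectorDecay
import Summits.Ventures.HodgeRepro2.T5BergmanCoeffOrtho
import Summits.Ventures.HodgeRepro2.T5BergmanKernel
import Summits.Ventures.HodgeRepro2.T5BergmanCoefficientL2

/-!
# The one-vector Fourier coefficient is a matrix coefficient with fixed vectors; `hq` holds in the model
(support, seat p1)

For the line's ONE-vector test function `f(g) = ⟨π_k(g) 1, 1⟩_k` (L3-ARGUMENT §2g; memo v13's rewritten clause (5),
STATUS l. 15190: «Φ_q(γ) = ⟨u_A, π⁰(γh) P_q π⁰(h⁻¹) u_A⟩ = c_q ⟨u_A, π⁰(γh) z^q⟩ with c_q the q-th Taylor coefficient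
of π⁰(h⁻¹) u_A») this file computes, in the weight-`k` Bergman model:

* `φ_h := π_k(h⁻¹) 1` is the coherent state `a(h⁻¹)^{−k} K_{h⁻¹·0}` with Taylor coefficients
  `c_m(h) = a(h⁻¹)^{−k} C(m+k−1, m) conj(h⁻¹·0)^m` (`coherent`, `coherentCoeff`, `hasSum_coherent`);
* along the second-torus orbit the one-vector coefficient is a right-rotated coefficient of `φ_h`
  (`matrixCoeff_lowest_conj_torus`: `⟨π_k(γ h rot(w) h⁻¹) 1, 1⟩_k = ⟨π_k(γ h rot(w)) φ_h, 1⟩_k`), so the `K`-type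
  projection of `T5BergmanCoeffOrtho.integral_circle_pow_mul_matrixCoeff` evaluates the Fourier coefficient of
  `T7SupportBergmanOneVectorDecay.lowestFourierCoeff`:

  **`Φ_{−(k+2m)}(γ) = c_m(h) · ⟨π_k(γ h) zᵐ, 1⟩_k`**   (`lowestFourierCoeff_eq`)

  — a matrix coefficient with FIXED vectors `zᵐ`, `1`, times the constant `c_m(h)`;
* at `γ = 1`: `Φ_{−(k+2m)}(1) = |c_m(h)|² ⟨zᵐ, zᵐ⟩_k` (`lowestFourierCoeff_one`), and `c_m(h) ≠ 0` for every `m` as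
  soon as `h ∉ K`, i.e. `b(h) ≠ 0` (`coherentCoeff_ne_zero`); hence **row 696's displayed hypothesis `hq`
  («`u_A` has a non-zero `(T_B, q)`-component») HOLDS in the model for every `K`-type `q = −(k+2m)` when `h ∉ K`**
  (`lowestFourierCoeff_one_ne_zero`), and `γ₀ = 1` is then regular (`kappa_one_ne_one`): the two-torus orbital
  integral of the one-vector `f` at `γ₀ = 1` is non-zero (`torus_orbital_lowest_one_ne_zero`) — memo v13's
  «at γ₀ = 1, a_1 ≠ 0 IS ∏_v hq_v» discharged at the rank-one places in the explicit model, for the lowest-weight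
  vector `u_A = 1` and every admissible `q`.

Explicit model only; nothing about the adelic group, the global invariant, or any period.
Blind lane: Mathlib + the HodgeRepro2 prefix only; no sorry; axioms ⊆ {propext, Classical.choice, Quot.sound}.
-/

namespace Summit.Ventures.HodgeRepro2.T7SupportBergmanOneVectorFourier

open MeasureTheory Metric
open T5SU11Unimodular T5SU11Fibration T5BergmanCoefficient T5BergmanMatrixCoeff T5HaarCircle T5BergmanActStable
  T5BergmanKernel T5BergmanParseval T5BergmanFourier T5BergmanUnitary T5BergmanCoefficientL2 T5BergmanCoeffOrtho
  T7SupportTwoTorusInvariant T7SupportKappaCartan T7SupportCartanShift T7SupportBergmanOneVectorDecay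

/-- **the translated lowest-weight vector** `φ_h = π_k(h⁻¹) 1` -/
noncomputable def coherent (k : ℕ) (h : SU11) : ℂ → ℂ := act k h⁻¹ lowest

/-- **its Taylor coefficients** `c_m(h) = a(h⁻¹)^{−k} · C(m+k−1, m) · conj(h⁻¹·0)^m` -/
noncomputable def coherentCoeff (k : ℕ) (h : SU11) (m : ℕ) : ℂ :=
  (mat h⁻¹ 0 0)⁻¹ ^ k * kernelCoeff k (orbit h⁻¹) m

/-- `φ_h = Σ_m c_m(h) zᵐ` on the disc -/
theorem hasSum_coherent (k : ℕ) (hk : 2 ≤ k) (h : SU11) {w : ℂ} (hw : w ∈ ball (0 : ℂ) 1) :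
    HasSum (fun m => coherentCoeff k h m * w ^ m) (coherent k h w) := by
  unfold coherent coherentCoeff
  rw [act_lowest_eq_kernel]
  simp_rw [mul_assoc]
  exact (hasSum_kernel k hk (orbit_mem_ball h⁻¹) hw).mul_left _

/-- `φ_h` is holomorphic on the disc -/
theorem differentiableOn_coherent (k : ℕ) (h : SU11) : DifferentiableOn ℂ (coherent k h) (ball 0 1) :=
  (differentiableOn_act_lowest k h⁻¹).mono ball_subset_closedBall

/-- `1 = Σ_n δ_{n0} zⁿ` -/
theorem hasSum_lowest (w : ℂ) : HasSum (fun n => (if n = 0 then (1 : ℂ) else 0) * w ^ n) (lowest w) := by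
  have h := hasSum_ite_eq (0 : ℕ) (w ^ 0)
  simp only [lowest, pow_zero] at h ⊢
  refine h.congr_fun fun j => ?_
  by_cases hj : j = 0 <;> simp [hj]

/-- the lowest-weight vector lies in `A_k` -/
theorem integrableOn_lowest (k : ℕ) :
    IntegrableOn (fun w => ‖lowest w‖ ^ 2 * (1 - ‖w‖ ^ 2) ^ (k - 2)) (ball (0 : ℂ) 1) := by
  simpa [lowest] using integrableOn_monomial k 0

/-- `φ_h` lies in `A_k` -/
theorem integrableOn_coherent (k : ℕ) (hk : 2 ≤ k) (h : SU11) :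
    IntegrableOn (fun w => ‖coherent k h w‖ ^ 2 * (1 - ‖w‖ ^ 2) ^ (k - 2)) (ball (0 : ℂ) 1) :=
  integrableOn_act k hk h⁻¹ lowest (differentiableOn_const 1) (integrableOn_lowest k)

/-- **the one-vector coefficient along the second-torus orbit is a right-rotated coefficient of `φ_h`**:
`⟨π_k(γ h rot(w) h⁻¹) 1, 1⟩_k = ⟨π_k(γ h rot(w)) φ_h, 1⟩_k` -/
theorem matrixCoeff_lowest_conj_torus (k : ℕ) (γ h : SU11) (w : Circle) :
    matrixCoeff k lowest lowest (γ * (h * rot w * h⁻¹)) = matrixCoeff k (coherent k h) lowest (γ * h * rot w) := by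
  have e : γ * (h * rot w * h⁻¹) = (γ * h * rot w) * h⁻¹ := by group
  rw [e, matrixCoeff_mul]
  rfl

/-- `conj((w^{k+2m})⁻¹) = w^{k+2m}` on the circle -/
theorem conj_zpow_neg_natCast (w : Circle) (N : ℕ) :
    (starRingEnd ℂ) ((w : ℂ) ^ (-(N : ℤ))) = (w : ℂ) ^ N := by
  rw [zpow_neg, zpow_natCast, map_inv₀, map_pow, ← Circle.coe_inv_eq_conj, Circle.coe_inv, inv_pow, inv_inv]

/-- `⟨π_k(h) zᵐ, 1⟩_k = conj(c_m(h)) ⟨zᵐ, zᵐ⟩_k` -/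
theorem matrixCoeff_monomial_lowest_eq (k : ℕ) (hk : 2 ≤ k) (h : SU11) (m : ℕ) :
    matrixCoeff k (fun w => w ^ m) lowest h = (starRingEnd ℂ) (coherentCoeff k h m) * monomialNormSq k m := by
  unfold matrixCoeff
  rw [pairing_act_left k hk h]
  change pairing k (fun w => w ^ m) (coherent k h) = _
  rw [pairing_conj_symm, pairing_monomial_right k hk (coherentCoeff k h) (coherent k h)
    (fun w hw => hasSum_coherent k hk h hw) (integrableOn_coherent k hk h) m]
  rw [map_mul, Complex.conj_ofReal]

/-- `h⁻¹ · 0 = −b(h)/a(h)`; it is non-zero iff `b(h) ≠ 0`, i.e. iff `h ∉ K` -/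
theorem orbit_inv_ne_zero {h : SU11} (hb : mat h 0 1 ≠ 0) : orbit h⁻¹ ≠ 0 := by
  rw [orbit_eq, mat_inv_zero_one, mat_inv_zero_zero, Complex.conj_conj]
  exact div_ne_zero (neg_ne_zero.2 hb) (mat_zero_zero_ne_zero h)

/-- the kernel coefficients are non-zero for `z ≠ 0` -/
theorem kernelCoeff_ne_zero (k : ℕ) (hk : 2 ≤ k) {z : ℂ} (hz : z ≠ 0) (m : ℕ) : kernelCoeff k z m ≠ 0 := by
  unfold kernelCoeff
  refine mul_ne_zero ?_ (pow_ne_zero _ ((map_ne_zero _).2 hz))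
  have : 0 < (m + k - 1).choose m := Nat.choose_pos (by omega)
  exact_mod_cast this.ne'

/-- **`c_m(h) ≠ 0` for every `m` when `h ∉ K`** -/
theorem coherentCoeff_ne_zero (k : ℕ) (hk : 2 ≤ k) {h : SU11} (hb : mat h 0 1 ≠ 0) (m : ℕ) :
    coherentCoeff k h m ≠ 0 :=
  mul_ne_zero (pow_ne_zero _ (inv_ne_zero (mat_zero_zero_ne_zero h⁻¹)))
    (kernelCoeff_ne_zero k hk (orbit_inv_ne_zero hb) m)

/-- `γ₀ = 1` is REGULAR (`κ(1) ≠ 1`) exactly when `h ∉ K` -/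
theorem kappa_one_ne_one {h : SU11} (hb : mat h 0 1 ≠ 0) :
    kappa (starRingEnd ℂ) dd (colBasis h) (mat 1) ≠ 1 := by
  rw [Ne, kappa_eq_one_iff 1 h, one_mul, mat_one_zero]
  exact (map_ne_zero _).2 hb

variable [MeasurableSpace Circle] [BorelSpace Circle]

/-- **`Φ_{−(k+2m)}(γ) = c_m(h) ⟨π_k(γ h) zᵐ, 1⟩_k`** — the one-vector Fourier coefficient is a matrix coefficient
with fixed vectors -/
theorem lowestFourierCoeff_eq (k : ℕ) (hk : 2 ≤ k) (h : SU11) (m : ℕ) (γ : SU11) :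
    lowestFourierCoeff k h (-((k + 2 * m : ℕ) : ℤ)) γ =
      coherentCoeff k h m * matrixCoeff k (fun w => w ^ m) lowest (γ * h) := by
  unfold lowestFourierCoeff
  have e : ∀ w : Circle,
      (starRingEnd ℂ) ((w : ℂ) ^ (-((k + 2 * m : ℕ) : ℤ))) * matrixCoeff k lowest lowest (γ * (h * rot w * h⁻¹)) =
      (w : ℂ) ^ (k + 2 * m) * matrixCoeff k (coherent k h) lowest (γ * h * rot w) := by
    intro w
    rw [matrixCoeff_lowest_conj_torus, conj_zpow_neg_natCast]
  simp_rw [e]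
  exact integral_circle_pow_mul_matrixCoeff k hk (coherentCoeff k h) (coherent k h) (differentiableOn_coherent k h)
    (fun w hw => hasSum_coherent k hk h hw) (integrableOn_coherent k hk h) (fun n => if n = 0 then 1 else 0) lowest
    (fun w _ => hasSum_lowest w) (integrableOn_lowest k) m (γ * h)

/-- **`Φ_{−(k+2m)}(1) = |c_m(h)|² ⟨zᵐ, zᵐ⟩_k`** -/
theorem lowestFourierCoeff_one (k : ℕ) (hk : 2 ≤ k) (h : SU11) (m : ℕ) :
    lowestFourierCoeff k h (-((k + 2 * m : ℕ) : ℤ)) 1 =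
      (Complex.normSq (coherentCoeff k h m) : ℂ) * monomialNormSq k m := by
  rw [lowestFourierCoeff_eq k hk h m 1, one_mul, matrixCoeff_monomial_lowest_eq k hk h m,
    Complex.normSq_eq_conj_mul_self]
  ring

/-- **`hq` holds in the model**: `Φ_{−(k+2m)}(1) ≠ 0` for every `m` when `h ∉ K` (row 696's displayed
hypothesis `torus_orbital_one_vector_at_one_ne_zero` discharged for the lowest-weight vector) -/
theorem lowestFourierCoeff_one_ne_zero (k : ℕ) (hk : 2 ≤ k) {h : SU11} (hb : mat h 0 1 ≠ 0) (m : ℕ) :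
    lowestFourierCoeff k h (-((k + 2 * m : ℕ) : ℤ)) 1 ≠ 0 := by
  rw [lowestFourierCoeff_one k hk h m]
  refine mul_ne_zero ?_ ?_
  · exact_mod_cast (Complex.normSq_pos.2 (coherentCoeff_ne_zero k hk hb m)).ne'
  · exact_mod_cast (monomialNormSq_pos k m).ne'

/-- **`a_{γ₀} ≠ 0` at `γ₀ = 1` for the line's one-vector `f` in the model**: with the first-torus character `u^k`
(the `K`-type of `1`) and the second-torus character `conj(w^{−(k+2m)})`, the two-torus orbital integral of
`⟨π_k(·) 1, 1⟩_k` at `γ₀ = 1` is `|c_m(h)|² ⟨zᵐ, zᵐ⟩_k ≠ 0` whenever `h ∉ K` -/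
theorem torus_orbital_lowest_one_ne_zero (k : ℕ) (hk : 2 ≤ k) {h : SU11} (hb : mat h 0 1 ≠ 0) (m : ℕ) :
    ∫ u : Circle, ∫ w : Circle, matrixCoeff k lowest lowest (rot u * 1 * (h * rot w * h⁻¹)) *
        ((u : ℂ) ^ (k : ℤ) * (starRingEnd ℂ) ((w : ℂ) ^ (-((k + 2 * m : ℕ) : ℤ))))
        ∂haarCircle ∂haarCircle ≠ 0 := by
  rw [torus_orbital_lowest_eq k h 1 (k : ℤ) (-((k + 2 * m : ℕ) : ℤ)), if_pos rfl, one_mul]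
  exact lowestFourierCoeff_one_ne_zero k hk hb m

end Summit.Ventures.HodgeRepro2.T7SupportBergmanOneVectorFourier
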